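import Summits.QuantumFields.YangMills.Theorems.LangevinControlUVOSLegsAtWeakCouplingCDefs
import Summits.QuantumFields.YangMills.Theorems.LangevinControlUVOSLegsAtWeakCouplingCStubRopeCutoff
import Literature.MathematicalPhysics.AQFT.OffDiagonalFlatDecay
import Literature.MathematicalPhysics.QuantumLattice.SchwartzTranslationCutoff
import HarnessLib

/-!
# Flat approximation of `⁰𝒮` test functions by compactly supported functions supported off the diagonal

Helper file for stub `stub_locality` of crux `OSLegsAtWeakCouplingC` (stmt-QuantumFields-16207, line `Sketch`):
the density step.  Every `F ∈ ⁰𝒮((ℝ⁴)ⁿ)` (a Schwartz `n`-point test function vanishing with ALL derivatives on the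
coincidence locus, `IsOffDiagonal`) is the limit IN THE SCHWARTZ TOPOLOGY of compactly supported Schwartz functions
each of which is supported at pairwise distances `≥ δ` for some `δ > 0` (`Separated n δ`; `δ` may shrink along the
sequence).  Whitney-type argument:

* `exists_pairCutoff` — a smooth `Ψ(x) = ∏_{a ≠ b} (1 − χ(x_a − x_b))` (`χ` a bump equal to `1` on the unit ball,
  supported in the ball of radius `2`) with all derivatives bounded, vanishing unless all pairs are at distance `> 1`
  and equal to `1` once all pairs are at distance `≥ 2`; its rescalings `ψ_m(x) = Ψ((m+1) x)` have
  `‖Dⁱ ψ_m‖ ≤ Kᵢ (m+1)ⁱ` (`norm_iteratedFDeriv_comp_right_le_mul_pow`);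
* `norm_iteratedFDeriv_le_of_isOffDiagonal` — the derivatives of an off-diagonal `G` are flat at the locus:
  `‖Dʲ G(y)‖ ≤ ‖G‖_{0,i+1+j} ‖y_b − y_a‖^{i+1} / i!` (Taylor with vanishing Taylor polynomial applied to `Dʲ G`,
  `norm_iteratedFDeriv_iteratedFDeriv`);
* `exists_pairCutoff_tendsto` — for a COMPACTLY supported off-diagonal `G`, `ψ_m G → G` in `𝓢`: by Leibniz every term
  `‖Dⁱ(1 − ψ_m)‖ ‖D^{l−i} G‖` is `O((m+1)ⁱ) · O((m+1)^{-(i+1)})` on the shell where `1 − ψ_m ≠ 0` (some pair at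
  distance `≤ 2/(m+1)`), and `ψ_m G` is supported at pairwise distances `≥ 1/(m+1)`;
* `exists_separated_tendsto_of_isOffDiagonal` — the registered statement: combine with the compact cutoffs inside `⁰𝒮`
  (`exists_offDiagonal_cutoff_tendsto'`) and extract a sequence from the closure (the Schwartz space is Fréchet).

Refs: Hörmander, ALPDO I, Lemma 7.1.8 (density of `C_c^∞` in `𝒮`); Osterwalder–Schrader 1973 §2 (the spaces `⁰𝒮`,
`𝒮(ℝ^{4n}_0)`); the flatness input is `Literature/MathematicalPhysics/AQFT/OffDiagonalFlatDecay`.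
-/

noncomputable section

open scoped SchwartzMap ContDiff Nat
open Filter Topology Set Metric
open Literature.MathematicalPhysics.AQFT Literature.MathematicalPhysics.QuantumLattice

namespace Summit.QuantumFields.YangMills.Theorems.OSLegsAtWeakCouplingC

section General

variable {V W V' : Type*} [NormedAddCommGroup V] [NormedSpace ℝ V] [NormedAddCommGroup W] [NormedSpace ℝ W]
  [NormedAddCommGroup V'] [NormedSpace ℝ V']

/-- Precomposition with a continuous linear map of norm `≤ C` multiplies the norm of the `i`-th derivative by at
most `C ^ i`: `‖Dⁱ(g ∘ L) x‖ ≤ ‖Dⁱ g (L x)‖ C ^ i`. -/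
theorem norm_iteratedFDeriv_comp_right_le_mul_pow {g : W → V'} (hg : ContDiff ℝ ∞ g) (L : V →L[ℝ] W) {C : ℝ}
    (hL : ‖L‖ ≤ C) (i : ℕ) (x : V) :
    ‖iteratedFDeriv ℝ i (g ∘ L) x‖ ≤ ‖iteratedFDeriv ℝ i g (L x)‖ * C ^ i := by
  rw [L.iteratedFDeriv_comp_right hg x (by exact_mod_cast le_top)]
  refine (ContinuousMultilinearMap.norm_compContinuousLinearMap_le _ _).trans
    (mul_le_mul_of_nonneg_left ?_ (norm_nonneg _))
  calc ∏ _ : Fin i, ‖L‖ ≤ ∏ _ : Fin i, C := Finset.prod_le_prod (fun _ _ => norm_nonneg _) fun _ _ => hL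
    _ = C ^ i := by simp

/-- `‖Dᵏ (Dʲ f) x‖ = ‖D^{k+j} f x‖` (uncurrying is an isometry). -/
theorem norm_iteratedFDeriv_iteratedFDeriv (f : V → V') (x : V) (j k : ℕ) :
    ‖iteratedFDeriv ℝ k (iteratedFDeriv ℝ j f) x‖ = ‖iteratedFDeriv ℝ (k + j) f x‖ := by
  induction j generalizing k with
  | zero => rw [iteratedFDeriv_zero_eq_comp, LinearIsometryEquiv.norm_iteratedFDeriv_comp_left, add_zero]
  | succ j ih =>
    -- the instance path of `V →L[ℝ] _` needs the spaces spelled out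
    rw [iteratedFDeriv_succ_eq_comp_left, LinearIsometryEquiv.norm_iteratedFDeriv_comp_left (𝕜 := ℝ) (E := V)
      (F := V →L[ℝ] ContinuousMultilinearMap ℝ (fun _ : Fin j => V) V')
      (G := ContinuousMultilinearMap ℝ (fun _ : Fin (j + 1) => V) V'),
      norm_iteratedFDeriv_fderiv, ih, show k + 1 + j = k + (j + 1) by omega]

variable {E : Type*} [NormedAddCommGroup E] [NormedSpace ℝ E] {n : ℕ}

/-- **The derivatives of a `⁰𝒮` function are flat at the coincidence locus** (pair form): for `G ∈ ⁰𝒮(Eⁿ)`,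
`a ≠ b` and all orders `i, j`, `‖Dʲ G (y)‖ ≤ ‖G‖_{0,i+1+j} ‖y_b − y_a‖^{i+1} / i!` — Taylor's formula at the coincident
point `z` (`y` with `y_b` replaced by `y_a`) for `Dʲ G`, whose Taylor polynomial at `z` vanishes identically. -/
theorem norm_iteratedFDeriv_le_of_isOffDiagonal {G : 𝓢((Fin n → E), ℂ)} (hG : IsOffDiagonal G) {a b : Fin n}
    (hab : a ≠ b) (y : Fin n → E) (i j : ℕ) :
    ‖iteratedFDeriv ℝ j G y‖ ≤ SchwartzMap.seminorm ℝ 0 (i + 1 + j) G * ‖y b - y a‖ ^ (i + 1) / i ! := by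
  have hz : Function.update y b (y a) ∈ coincidenceLocus n E := update_mem_coincidenceLocus hab y
  have hsm : ContDiff ℝ (i + 1 : ℕ) (iteratedFDeriv ℝ j (G : (Fin n → E) → ℂ)) :=
    (G.smooth ⊤).iteratedFDeriv_right (by exact_mod_cast le_top)
  have h := norm_le_of_iteratedFDeriv_eq_zero (f := iteratedFDeriv ℝ j (G : (Fin n → E) → ℂ))
    (x := Function.update y b (y a)) (y := y - Function.update y b (y a)) (M := i)
    (C := SchwartzMap.seminorm ℝ 0 (i + 1 + j) G) (fun t _ => hsm.contDiffAt) ?_ ?_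
  · rwa [add_sub_cancel, norm_sub_update_eq a b y] at h
  · intro k _
    rw [← norm_eq_zero, norm_iteratedFDeriv_iteratedFDeriv, hG _ hz (k + j), norm_zero]
  · intro t _
    rw [norm_iteratedFDeriv_iteratedFDeriv]
    exact SchwartzMap.norm_iteratedFDeriv_le_seminorm ℝ G _ _

end General

section PairCutoff

variable {E : Type*} [NormedAddCommGroup E] [NormedSpace ℝ E] [FiniteDimensional ℝ E]

/-- **The pair cutoff.** On `(Fin n → E)` (`E` finite dimensional) there is a smooth `Ψ` with all derivatives
bounded, `Ψ x ≠ 0` only if all pairs `x_a, x_b` (`a ≠ b`) are at distance `> 1`, and `Ψ x = 1` as soon as all pairs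
are at distance `≥ 2`: `Ψ(x) = ∏_{a ≠ b} (1 − χ(x_a − x_b))` for a bump `χ` equal to `1` on the closed unit ball and
supported in the ball of radius `2` (uniform Leibniz bounds `exists_bound_iteratedFDeriv_prod`). -/
theorem exists_pairCutoff (n : ℕ) :
    ∃ Ψ : (Fin n → E) → ℝ, ContDiff ℝ ∞ Ψ ∧ (∀ i, ∃ K : ℝ, ∀ x, ‖iteratedFDeriv ℝ i Ψ x‖ ≤ K) ∧
      (∀ x, Ψ x ≠ 0 → ∀ a b : Fin n, a ≠ b → 1 < ‖x a - x b‖) ∧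
      (∀ x, (∀ a b : Fin n, a ≠ b → 2 ≤ ‖x a - x b‖) → Ψ x = 1) := by
  let χ : ContDiffBump (0 : E) := ⟨1, 2, one_pos, one_lt_two⟩
  let P : Finset (Fin n × Fin n) := Finset.univ.filter fun p => p.1 ≠ p.2
  let π : Fin n × Fin n → (Fin n → E) →L[ℝ] E := fun p =>
    (ContinuousLinearMap.proj p.1 : (Fin n → E) →L[ℝ] E) - (ContinuousLinearMap.proj p.2 : (Fin n → E) →L[ℝ] E)
  let u : Fin n × Fin n → (Fin n → E) → ℝ := fun p x => 1 - ((χ : E → ℝ) ∘ π p) x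
  have hπ : ∀ p x, π p x = x p.1 - x p.2 := fun p x => by simp [π]
  have hu : ∀ p x, u p x = 1 - χ (x p.1 - x p.2) := fun p x => by simp [u, Function.comp, hπ]
  have hχs : ContDiff ℝ ∞ (χ : E → ℝ) := χ.contDiff
  have hus : ∀ p, ContDiff ℝ ∞ (u p) := fun p => contDiff_const.sub (hχs.comp (π p).contDiff)
  have hM : ∀ i : ℕ, ∃ M : ℝ, ∀ y, ‖iteratedFDeriv ℝ i (χ : E → ℝ) y‖ ≤ M := fun i => by
    obtain ⟨x₀, hx₀⟩ := ((hχs.continuous_iteratedFDeriv (m := i)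
      (by exact_mod_cast le_top)).norm).exists_forall_ge_of_hasCompactSupport
      ((χ.hasCompactSupport.iteratedFDeriv i).norm)
    exact ⟨_, hx₀⟩
  choose M hM using hM
  have hπn : ∀ p, ‖π p‖ ≤ 2 := fun p => by
    refine ContinuousLinearMap.opNorm_le_bound _ (by norm_num) fun x => ?_
    rw [hπ]
    calc ‖x p.1 - x p.2‖ ≤ ‖x p.1‖ + ‖x p.2‖ := norm_sub_le _ _
      _ ≤ ‖x‖ + ‖x‖ := add_le_add (norm_le_pi_norm x _) (norm_le_pi_norm x _)
      _ = 2 * ‖x‖ := by ring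
  have hub : ∀ p j x, ‖iteratedFDeriv ℝ j (u p) x‖ ≤ M j * 2 ^ j + 1 := fun p j x => by
    refine norm_iteratedFDeriv_one_sub_le (hχs.comp (π p).contDiff) (A := fun j => M j * 2 ^ j)
      (fun j y => ?_) j x
    exact (norm_iteratedFDeriv_comp_right_le_mul_pow hχs (π p) (hπn p) j y).trans
      (mul_le_mul_of_nonneg_right (hM j _) (by positivity))
  obtain ⟨A', hA'⟩ := exists_bound_iteratedFDeriv_prod (X := Fin n → E) (ι' := Fin n × Fin n)
    (fun j => M j * 2 ^ j + 1) P.card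
  refine ⟨fun x => ∏ p ∈ P, u p x, contDiff_prod fun p _ => hus p,
    fun i => ⟨A' i, fun x => hA' P le_rfl u (fun p _ => hus p) (fun p _ j y => hub p j y) i x⟩,
    fun x hx a b hab => ?_, fun x hx => ?_⟩
  · by_contra h
    refine hx (Finset.prod_eq_zero (i := (a, b)) (Finset.mem_filter.2 ⟨Finset.mem_univ _, hab⟩) ?_)
    rw [hu, χ.one_of_mem_closedBall (mem_closedBall_zero_iff.2 (not_lt.1 h)), sub_self]
  · refine Finset.prod_eq_one fun p hp => ?_
    rw [hu, χ.zero_of_le_dist (by simpa using hx p.1 p.2 (Finset.mem_filter.1 hp).2), sub_zero]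

variable {n : ℕ}

/-- **Pair cutoffs of a compactly supported `⁰𝒮` function converge in `𝓢`.**  For an off-diagonal `G` supported in a
ball there are `v m ∈ 𝓢` (namely `ψ_m G`, `ψ_m(x) = Ψ((m+1) x)` with `Ψ` the pair cutoff) supported inside
`tsupport G` and at pairwise distances `≥ 1/(m+1)`, with `v m → G` in the Schwartz topology.  Leibniz: on the shell
where `1 − ψ_m` does not vanish identically near `x` some pair is at distance `≤ 2/(m+1)`, where the flatness of the
derivatives of `G` (`norm_iteratedFDeriv_le_of_isOffDiagonal`) beats the growth `(m+1)ⁱ` of `Dⁱ ψ_m`. -/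
theorem exists_pairCutoff_tendsto {G : 𝓢((Fin n → E), ℂ)} (hG : IsOffDiagonal G) {R : ℝ}
    (hR : tsupport (G : (Fin n → E) → ℂ) ⊆ closedBall 0 R) :
    ∃ v : ℕ → 𝓢((Fin n → E), ℂ), (∀ m, tsupport (v m : (Fin n → E) → ℂ) ⊆
      tsupport (G : (Fin n → E) → ℂ) ∩ {x | ∀ a b : Fin n, a ≠ b → ((m : ℝ) + 1)⁻¹ ≤ ‖x a - x b‖}) ∧
      Tendsto v atTop (𝓝 G) := by
  obtain ⟨Ψ, hΨs, hΨb, hΨ0, hΨ1⟩ := exists_pairCutoff (E := E) n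
  choose K hK using hΨb
  have hK0 : ∀ i, 0 ≤ K i := fun i => (norm_nonneg _).trans (hK i 0)
  have hd : ∀ m : ℕ, (0 : ℝ) < (m : ℝ) + 1 := fun m => by positivity
  let L : ℕ → (Fin n → E) →L[ℝ] (Fin n → E) := fun m => ((m : ℝ) + 1) • ContinuousLinearMap.id ℝ _
  let ψ : ℕ → (Fin n → E) → ℝ := fun m => Ψ ∘ L m
  have hψ_apply : ∀ m x, ψ m x = Ψ (((m : ℝ) + 1) • x) := fun m x => rfl
  have hψs : ∀ m, ContDiff ℝ ∞ (ψ m) := fun m => hΨs.comp (L m).contDiff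
  have hLn : ∀ m, ‖L m‖ ≤ (m : ℝ) + 1 := fun m => by
    change ‖((m : ℝ) + 1) • ContinuousLinearMap.id ℝ (Fin n → E)‖ ≤ _
    refine (norm_smul_le ((m : ℝ) + 1) (ContinuousLinearMap.id ℝ (Fin n → E))).trans ?_
    rw [Real.norm_of_nonneg (hd m).le]
    exact mul_le_of_le_one_right (hd m).le ContinuousLinearMap.norm_id_le
  have hψb : ∀ m i x, ‖iteratedFDeriv ℝ i (ψ m) x‖ ≤ K i * ((m : ℝ) + 1) ^ i := fun m i x =>
    (norm_iteratedFDeriv_comp_right_le_mul_pow hΨs (L m) (hLn m) i x).trans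
      (mul_le_mul_of_nonneg_right (hK i _) (by positivity))
  have hψt : ∀ m, (ψ m).HasTemperateGrowth := fun m => hasTemperateGrowth_of_bounds (hψs m) _ (hψb m)
  have hnorm : ∀ (m : ℕ) (x : Fin n → E) (a b : Fin n),
      ‖(((m : ℝ) + 1) • x) a - (((m : ℝ) + 1) • x) b‖ = ((m : ℝ) + 1) * ‖x a - x b‖ := by
    intro m x a b
    rw [Pi.smul_apply, Pi.smul_apply, ← smul_sub, norm_smul, Real.norm_of_nonneg (hd m).le]
  have hψ0 : ∀ m x, ψ m x ≠ 0 → ∀ a b : Fin n, a ≠ b → ((m : ℝ) + 1)⁻¹ < ‖x a - x b‖ := by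
    intro m x hx a b hab
    have h := hΨ0 (((m : ℝ) + 1) • x) hx a b hab
    rw [hnorm] at h
    rw [inv_eq_one_div, div_lt_iff₀ (hd m), mul_comm]
    exact h
  have hψ1 : ∀ (m : ℕ) (x : Fin n → E), (∀ a b : Fin n, a ≠ b → 2 * ((m : ℝ) + 1)⁻¹ ≤ ‖x a - x b‖) →
      ψ m x = 1 := by
    intro m x hx
    change Ψ (((m : ℝ) + 1) • x) = 1
    refine hΨ1 _ fun a b hab => ?_
    rw [hnorm, mul_comm]
    exact (mul_inv_le_iff₀ (hd m)).1 (hx a b hab)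
  refine ⟨fun m => SchwartzMap.smulLeftCLM ℂ (ψ m) G, fun m => ?_, ?_⟩
  · refine (SchwartzMap.tsupport_smulLeftCLM_subset _ _).trans (inter_subset_inter_right _ ?_)
    refine closure_minimal (fun x hx a b hab => (hψ0 m x hx a b hab).le) ?_
    have hcl : {x : Fin n → E | ∀ a b : Fin n, a ≠ b → ((m : ℝ) + 1)⁻¹ ≤ ‖x a - x b‖} =
        ⋂ a : Fin n, ⋂ b : Fin n, ⋂ (_ : a ≠ b), {x | ((m : ℝ) + 1)⁻¹ ≤ ‖x a - x b‖} := by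
      ext x; simp
    rw [hcl]
    exact isClosed_iInter fun a => isClosed_iInter fun b => isClosed_iInter fun _ =>
      isClosed_le continuous_const ((continuous_apply a).sub (continuous_apply b)).norm
  -- the seminorm estimate `‖G - ψ_m G‖_{k,l} ≤ C / (m + 1)`
  have hest : ∀ k l : ℕ, ∃ C : ℝ, 0 ≤ C ∧ ∀ m : ℕ,
      SchwartzMap.seminorm ℝ k l (G - SchwartzMap.smulLeftCLM ℂ (ψ m) G) ≤ C / ((m : ℝ) + 1) := by
    intro k l
    have hc0 : ∀ i, 0 ≤ (l.choose i : ℝ) * (K i + 1) * SchwartzMap.seminorm ℝ 0 (i + 1 + (l - i)) G *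
        2 ^ (i + 1) / i ! := fun i => by
      have := hK0 i
      have := apply_nonneg (SchwartzMap.seminorm ℝ 0 (i + 1 + (l - i))) G
      positivity
    refine ⟨max R 1 ^ k * ∑ i ∈ Finset.range (l + 1), (l.choose i : ℝ) * (K i + 1) *
      SchwartzMap.seminorm ℝ 0 (i + 1 + (l - i)) G * 2 ^ (i + 1) / i !,
      mul_nonneg (by positivity) (Finset.sum_nonneg fun i _ => hc0 i), fun m => ?_⟩
    have hC0 : 0 ≤ max R 1 ^ k * (∑ i ∈ Finset.range (l + 1), (l.choose i : ℝ) * (K i + 1) *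
        SchwartzMap.seminorm ℝ 0 (i + 1 + (l - i)) G * 2 ^ (i + 1) / i !) / ((m : ℝ) + 1) :=
      div_nonneg (mul_nonneg (by positivity) (Finset.sum_nonneg fun i _ => hc0 i)) (hd m).le
    refine SchwartzMap.seminorm_le_bound ℝ k l _ hC0 fun x => ?_
    have hcoe : (⇑(G - SchwartzMap.smulLeftCLM ℂ (ψ m) G) : (Fin n → E) → ℂ) =
        fun y => (1 - ψ m y) • G y := by
      funext y
      simp only [sub_apply, SchwartzMap.smulLeftCLM_apply_apply (hψt m), sub_smul, one_smul]
    rw [hcoe]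
    by_cases hx : x ∈ tsupport (G : (Fin n → E) → ℂ) ∧ ∃ a b : Fin n, a ≠ b ∧ ‖x a - x b‖ ≤ 2 * ((m : ℝ) + 1)⁻¹
    · obtain ⟨hxG, a, b, hab, hxab⟩ := hx
      have hxR : ‖x‖ ≤ max R 1 := (mem_closedBall_zero_iff.1 (hR hxG)).trans (le_max_left _ _)
      have hsm : ContDiff ℝ l (fun y => 1 - ψ m y) :=
        (contDiff_const.sub (hψs m)).of_le (by exact_mod_cast le_top)
      have hleib := norm_iteratedFDeriv_smul_le (𝕜 := ℝ) hsm (G.smooth l) x (n := l) le_rfl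
      have hterm : ∀ i ∈ Finset.range (l + 1),
          (l.choose i : ℝ) * ‖iteratedFDeriv ℝ i (fun y => 1 - ψ m y) x‖ * ‖iteratedFDeriv ℝ (l - i) G x‖ ≤
            (l.choose i : ℝ) * (K i + 1) * SchwartzMap.seminorm ℝ 0 (i + 1 + (l - i)) G * 2 ^ (i + 1) / i ! /
              ((m : ℝ) + 1) := by
        intro i _
        have h1 : ‖iteratedFDeriv ℝ i (fun y => 1 - ψ m y) x‖ ≤ (K i + 1) * ((m : ℝ) + 1) ^ i := by
          refine (norm_iteratedFDeriv_one_sub_le (hψs m) (fun j y => hψb m j y) i x).trans ?_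
          have : (1 : ℝ) ≤ ((m : ℝ) + 1) ^ i := one_le_pow₀ (by linarith [(m.cast_nonneg : (0 : ℝ) ≤ m)])
          nlinarith [hK0 i]
        have h2 : ‖iteratedFDeriv ℝ (l - i) G x‖ ≤ SchwartzMap.seminorm ℝ 0 (i + 1 + (l - i)) G *
            (2 * ((m : ℝ) + 1)⁻¹) ^ (i + 1) / i ! :=
          (norm_iteratedFDeriv_le_of_isOffDiagonal hG hab.symm x i (l - i)).trans (by gcongr)
        have hs0 := apply_nonneg (SchwartzMap.seminorm ℝ 0 (i + 1 + (l - i))) G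
        calc (l.choose i : ℝ) * ‖iteratedFDeriv ℝ i (fun y => 1 - ψ m y) x‖ * ‖iteratedFDeriv ℝ (l - i) G x‖
            ≤ (l.choose i : ℝ) * ((K i + 1) * ((m : ℝ) + 1) ^ i) *
                (SchwartzMap.seminorm ℝ 0 (i + 1 + (l - i)) G * (2 * ((m : ℝ) + 1)⁻¹) ^ (i + 1) / i !) :=
              mul_le_mul (mul_le_mul_of_nonneg_left h1 (Nat.cast_nonneg _)) h2 (norm_nonneg _)
                (by have := hK0 i; positivity)
          _ = (l.choose i : ℝ) * (K i + 1) * SchwartzMap.seminorm ℝ 0 (i + 1 + (l - i)) G * 2 ^ (i + 1) / i ! /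
              ((m : ℝ) + 1) := by
              have hm0 : (m : ℝ) + 1 ≠ 0 := (hd m).ne'
              rw [mul_pow, inv_pow, pow_succ]
              field_simp
              ring
      calc ‖x‖ ^ k * ‖iteratedFDeriv ℝ l (fun y => (1 - ψ m y) • G y) x‖
          ≤ max R 1 ^ k * ∑ i ∈ Finset.range (l + 1), (l.choose i : ℝ) *
              ‖iteratedFDeriv ℝ i (fun y => 1 - ψ m y) x‖ * ‖iteratedFDeriv ℝ (l - i) G x‖ :=
            mul_le_mul (pow_le_pow_left₀ (norm_nonneg _) hxR k) hleib (norm_nonneg _) (by positivity)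
        _ ≤ max R 1 ^ k * ∑ i ∈ Finset.range (l + 1), (l.choose i : ℝ) * (K i + 1) *
              SchwartzMap.seminorm ℝ 0 (i + 1 + (l - i)) G * 2 ^ (i + 1) / i ! / ((m : ℝ) + 1) := by
            gcongr with i hi
            exact hterm i hi
        _ = max R 1 ^ k * (∑ i ∈ Finset.range (l + 1), (l.choose i : ℝ) * (K i + 1) *
              SchwartzMap.seminorm ℝ 0 (i + 1 + (l - i)) G * 2 ^ (i + 1) / i !) / ((m : ℝ) + 1) := by
            rw [← Finset.sum_div, mul_div_assoc]
    · -- `(1 - ψ_m) G` vanishes identically near `x`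
      have h0 : (fun y => (1 - ψ m y) • G y) =ᶠ[𝓝 x] 0 := by
        rcases not_and_or.1 hx with hx | hx
        · filter_upwards [notMem_tsupport_iff_eventuallyEq.1 hx] with y hy
          rw [hy, Pi.zero_apply, smul_zero]
        · push Not at hx
          have hU : IsOpen {y : Fin n → E | ∀ a b : Fin n, a ≠ b → 2 * ((m : ℝ) + 1)⁻¹ < ‖y a - y b‖} := by
            have hop : {y : Fin n → E | ∀ a b : Fin n, a ≠ b → 2 * ((m : ℝ) + 1)⁻¹ < ‖y a - y b‖} =
                ⋂ a : Fin n, ⋂ b : Fin n, ⋂ (_ : a ≠ b), {y | 2 * ((m : ℝ) + 1)⁻¹ < ‖y a - y b‖} := by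
              ext y; simp
            rw [hop]
            exact isOpen_iInter_of_finite fun a => isOpen_iInter_of_finite fun b =>
              isOpen_iInter_of_finite fun _ =>
                isOpen_lt continuous_const ((continuous_apply a).sub (continuous_apply b)).norm
          filter_upwards [hU.mem_nhds hx] with y hy
          rw [hψ1 m y fun a b hab => (hy a b hab).le, sub_self, zero_smul, Pi.zero_apply]
      rw [(h0.iteratedFDeriv ℝ l).eq_of_nhds, iteratedFDeriv_zero, Pi.zero_apply, norm_zero, mul_zero]
      exact hC0
  -- conclusion
  rw [(schwartz_withSeminorms ℝ (Fin n → E) ℂ).tendsto_nhds_atTop]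
  rintro ⟨k, l⟩ ε hε
  obtain ⟨C, hC0, hC⟩ := hest k l
  refine ⟨⌈C / ε⌉₊, fun m hm => ?_⟩
  rw [SchwartzMap.schwartzSeminormFamily_apply, map_sub_rev]
  have hm' : C / ε < (m : ℝ) + 1 :=
    (Nat.le_ceil _).trans_lt (by exact_mod_cast Nat.lt_succ_of_le hm)
  calc SchwartzMap.seminorm ℝ k l (G - SchwartzMap.smulLeftCLM ℂ (ψ m) G) ≤ C / ((m : ℝ) + 1) := hC m
    _ < ε := by
        rw [div_lt_iff₀ (hd m)]
        rw [div_lt_iff₀ hε] at hm'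
        linarith

end PairCutoff

end Summit.QuantumFields.YangMills.Theorems.OSLegsAtWeakCouplingC

namespace Summit.QuantumFields.YangMills.Cruxes.OSLegsAtWeakCouplingC.Sketch

open Summit.QuantumFields.YangMills.Theorems.OSLegsAtWeakCouplingC
open Summit.QuantumFields.YangMills.Theorems.OSLegsFromFemtoAndGap (exists_offDiagonal_cutoff_tendsto')

/-- **Flat approximation of `⁰𝒮` test functions (density step of `stub_locality`).**  Every `F ∈ ⁰𝒮((ℝ⁴)ⁿ)` —
a Schwartz `n`-point function vanishing with all derivatives on the coincidence locus — is the limit in the Schwartz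
topology of compactly supported Schwartz functions `u m`, each supported at pairwise distances `≥ δ_m` for some
`δ_m > 0` (`tsupport (u m) ⊆ Separated n δ_m`).  Proof: the compact bump cutoffs of `F` stay in `⁰𝒮`
(`exists_offDiagonal_cutoff_tendsto'`); each of them is the Schwartz limit of its pair cutoffs
(`exists_pairCutoff_tendsto`), which are compactly supported and separated; a sequence is extracted from the closure
since `𝓢` is first countable.  For `n ≤ 1` the statement is the plain density of compactly supported functions
(`Separated n δ = univ`), and the same proof applies. -/
theorem exists_separated_tendsto_of_isOffDiagonal {n : ℕ} (F : 𝓢((Fin n → EuclideanSpace ℝ (Fin 4)), ℂ)) (hF : IsOffDiagonal F) : ∃ u : ℕ → 𝓢((Fin n → EuclideanSpace ℝ (Fin 4)), ℂ), (∀ m, HasCompactSupport (u m : (Fin n → EuclideanSpace ℝ (Fin 4)) → ℂ)) ∧ (∀ m, ∃ δ : ℝ, 0 < δ ∧ tsupport (u m : (Fin n → EuclideanSpace ℝ (Fin 4)) → ℂ) ⊆ Separated n δ) ∧ Tendsto u atTop (𝓝 F) := by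
  set A : Set 𝓢((Fin n → EuclideanSpace ℝ (Fin 4)), ℂ) :=
    {u | HasCompactSupport (u : (Fin n → EuclideanSpace ℝ (Fin 4)) → ℂ) ∧
      ∃ δ : ℝ, 0 < δ ∧ tsupport (u : (Fin n → EuclideanSpace ℝ (Fin 4)) → ℂ) ⊆ Separated n δ} with hA
  suffices hF' : F ∈ closure A by
    obtain ⟨u, huA, hu⟩ := mem_closure_iff_seq_limit.1 hF'
    exact ⟨u, fun m => (huA m).1, fun m => (huA m).2, hu⟩
  obtain ⟨G, hGsupp, hGoff, hGlim⟩ := exists_offDiagonal_cutoff_tendsto' F hF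
  refine isClosed_closure.mem_of_tendsto hGlim (Eventually.of_forall fun m => ?_)
  obtain ⟨v, hv, hvlim⟩ := exists_pairCutoff_tendsto (hGoff m) ((hGsupp m).trans inter_subset_right)
  refine mem_closure_of_tendsto hvlim (Eventually.of_forall fun j => ⟨?_, ((j : ℝ) + 1)⁻¹, by positivity, ?_⟩)
  · exact IsCompact.of_isClosed_subset (isCompact_closedBall _ _) (isClosed_tsupport _)
      ((hv j).trans (inter_subset_left.trans ((hGsupp m).trans inter_subset_right)))
  · intro x hx
    simp only [Separated, Set.mem_setOf_eq, dist_eq_norm]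
    exact ((hv j) hx).2

end Summit.QuantumFields.YangMills.Cruxes.OSLegsAtWeakCouplingC.Sketch

end
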